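import Mathlib
import Literature.Analysis.ODE.GaussianBeamPhase1D
import Literature.Analysis.PDE.GaussianBeam1DEnergy
import Literature.Analysis.PDE.GaussianBeam1DData

/-!
# `WindowedShellChannels` (stmt-FinalStateConjecture-14085), the logarithmic lag law — III: the
# cut rest-beam package

Support file (prover seat 1; everything proved, no definitions). For a `C³` potential profile
`q > 0` with Lipschitz `q′`, a launch point `X₀`, a cut-off radius `δ₀ > 0` and a time horizon `T`,
this file packages the first-order Gaussian REST beam of `Literature.Analysis.ODE.exists_beamPhase`
(`β₀ = a₀ = 1`), cut off by a `ContDiffBump` of radii `δ₀/2, δ₀` around its centre `X(t)`, into the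
abstract data consumed by `LagLaw.stub_lagLawPacket`:

* the centre `X` with `X(0) = X₀`, `ξ(0) = 0`, Hamilton's equations in `HasDerivAt` form (for the
  saddle comparison `Literature.Analysis.ODE.trajectory_sub_le_cosh`) and `|X(t) − X(0)| ≤ |t|`;
* ONE constant `B ≥ 0` such that for EVERY frequency `μ ≥ max(1, 4/δ₀²)` the cut beam `G_μ` is
  jointly `C²`, vanishes for `|x − X(t)| ≥ δ₀`, has `∂_t G_μ(0,·) = 0`, residual
  `∫ (∂_t² − ∂_x² + μ²q) G_μ)² ≤ 2δ₀B²μ` on `[0, T]` (`cutBeam_residual_pointwise`,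
  `integral_sq_le_of_bound`), and potential energy of the datum at least `2e^{−1} q₀ μ^{3/2}`
  whenever `q ≥ q₀` on `[X₀ − δ₀, X₀ + δ₀]` (`cutBeam_initial_potential_ge`).

The last section fixes the constants of the lag law (`lagLaw_constants`): the rate `λ′ = 1/(θ′M)`,
`θ′ = (θ + 3√3)/2`, beats the photon-sphere Lyapunov exponent `λ = 1/(3√3 M)`, so continuity of
`q, q″` at the top gives a radius `D` on which `−q′(x) ≤ 2q(X₀)λ′²x` (the hypothesis of the saddle
comparison `Literature.Analysis.ODE.trajectory_sub_le_cosh`), and the horizon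
`T = θ′M log(D/(3ρ))` dominates `θ M log(M/ρ) + D` for small `ρ`.

[cite: Ralston1982, §2; Sbierski2015, §3]
-/

noncomputable section

-- every `Summit.FinalStateConjecture.FinalStateConjecture.…` name repeats the summit = sub-problem
-- segment (D-0017 layout), as in every landed `…Theorems` file of this route
set_option linter.dupNamespace false

namespace Summit.FinalStateConjecture.FinalStateConjecture.Theorems.LagLaw

open Literature.Analysis.ODE Literature.Analysis.PDE
open MeasureTheory Set Filter Topology Function Complex
open scoped ENNReal NNReal

/-- If `f` vanishes near `t`, then `f(t) = f′(t) = (iteratedDeriv 2 f)(t) = 0`. -/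
theorem derivs_eq_zero_of_eventuallyEq_zero {f : ℝ → ℝ} {t : ℝ} (h : f =ᶠ[𝓝 t] fun _ => 0) :
    f t = 0 ∧ deriv f t = 0 ∧ iteratedDeriv 2 f t = 0 := by
  have hd : deriv f =ᶠ[𝓝 t] fun _ => 0 := by
    filter_upwards [eventually_eventually_nhds.2 h] with z hz
    have hz' : f =ᶠ[𝓝 z] fun _ => 0 := hz
    rw [hz'.deriv_eq, deriv_const]
  refine ⟨h.self_of_nhds, by rw [h.deriv_eq, deriv_const], ?_⟩
  rw [iteratedDeriv_succ, iteratedDeriv_one, hd.deriv_eq, deriv_const]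

/-- **The cut rest-beam package.** See the module docstring. -/
theorem beam_package {q : ℝ → ℝ} (hq : ContDiff ℝ 3 q) {K : ℝ≥0} (hK : LipschitzWith K (deriv q))
    (hqpos : ∀ x, 0 < q x) (X₀ : ℝ) {δ₀ : ℝ} (hδ₀ : 0 < δ₀) (T : ℝ) :
    ∃ (X ξ : ℝ → ℝ), X 0 = X₀ ∧ ξ 0 = 0 ∧ ContDiff ℝ 2 X ∧
      (∀ t, HasDerivAt X (ξ t / Real.sqrt (q X₀)) t) ∧
      (∀ t, HasDerivAt ξ (-(deriv q (X t)) / (2 * Real.sqrt (q X₀))) t) ∧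
      (∀ t, |X t - X 0| ≤ |t|) ∧
      ∃ B : ℝ, 0 ≤ B ∧ ∀ μ : ℝ, 1 ≤ μ → 4 / δ₀ ^ 2 ≤ μ →
        ∃ G : ℝ → ℝ → ℝ, ContDiff ℝ 2 (uncurry G) ∧
          (∀ t x, δ₀ ≤ |x - X t| → G t x = 0) ∧
          (∀ x, deriv (fun τ => G τ x) 0 = 0) ∧
          (∀ t ∈ Icc 0 T, ∫ x, (iteratedDeriv 2 (fun τ => G τ x) t - iteratedDeriv 2 (G t) x
              + μ ^ 2 * q x * G t x) ^ 2 ≤ 2 * δ₀ * (B ^ 2 * μ)) ∧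
          (∀ q₀ : ℝ, 0 ≤ q₀ → (∀ x ∈ Icc (X₀ - δ₀) (X₀ + δ₀), q₀ ≤ q x) →
              ENNReal.ofReal (μ ^ 2 * q₀ * Real.exp (-1) * (2 / Real.sqrt μ))
                ≤ ∫⁻ x, ENNReal.ofReal (μ ^ 2 * q x * G 0 x ^ 2)) := by
  obtain ⟨X, ξ, θ, Γ, a, hX0, hξ0, hθ0, hΓ0, ha0, hX2, hξ2, hθ2, hΓ2, ha2, hdX, hdξ, hcons, hdθ,
    hdΓ, hIm, hda, hdX0, hda0, hdΓ0⟩ := exists_beamPhase hq hK (hqpos X₀) one_pos (1 : ℂ)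
  have hω₀ : 0 < Real.sqrt (q X₀) := Real.sqrt_pos.2 (hqpos X₀)
  have hXd : Differentiable ℝ X := hX2.differentiable two_ne_zero
  have hξd : Differentiable ℝ ξ := hξ2.differentiable two_ne_zero
  have hXH : ∀ t, HasDerivAt X (ξ t / Real.sqrt (q X₀)) t := fun t => by
    have h := (hXd t).hasDerivAt; rwa [hdX t] at h
  have hξH : ∀ t, HasDerivAt ξ (-(deriv q (X t)) / (2 * Real.sqrt (q X₀))) t := fun t => by
    have h := (hξd t).hasDerivAt; rwa [hdξ t] at h
  -- `|X′| ≤ 1`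
  have hX1 : ∀ t, |deriv X t| ≤ 1 := by
    intro t
    rw [hdX t, abs_div, abs_of_pos hω₀, div_le_one hω₀]
    have h1 : ξ t ^ 2 ≤ Real.sqrt (q X₀) ^ 2 := by linarith [hcons t, hqpos (X t)]
    have h2 := sq_le_sq.1 h1
    rwa [abs_of_pos hω₀] at h2
  have hXlip : ∀ t, |X t - X 0| ≤ |t| := by
    intro t
    have h := Convex.norm_image_sub_le_of_norm_deriv_le (f := X) (C := 1) (s := univ)
      (fun x _ => hXd x) (fun x _ => by rw [Real.norm_eq_abs]; exact hX1 x) convex_univ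
      (mem_univ 0) (mem_univ t)
    rw [Real.norm_eq_abs, Real.norm_eq_abs, sub_zero, one_mul] at h
    exact h
  refine ⟨X, ξ, hX0, hξ0, hX2, hXH, hξH, hXlip, ?_⟩
  -- the cut-off
  let f : ContDiffBump (0 : ℝ) := ⟨δ₀ / 2, δ₀, by positivity, by linarith⟩
  have hχ : ContDiff ℝ 2 (f : ℝ → ℝ) := f.contDiff
  have hχ1 : ∀ y ∈ Icc (-(δ₀ / 2)) (δ₀ / 2), f y = 1 := fun y hy =>
    f.one_of_mem_closedBall (by
      rw [Metric.mem_closedBall, dist_zero_right, Real.norm_eq_abs]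
      exact abs_le.2 ⟨hy.1, hy.2⟩)
  have hχ0 : ∀ y, δ₀ ≤ |y| → f y = 0 := fun y hy =>
    f.zero_of_le_dist (by rw [dist_zero_right, Real.norm_eq_abs]; exact hy)
  -- the residual constant (uniform in `μ ≥ 1`)
  obtain ⟨B, hB0, hB⟩ := cutBeam_residual_pointwise hq hω₀.ne' hX2 hξ2 hθ2 hΓ2 ha2 hdX hdξ hcons
    hdθ hdΓ hda hIm hX1 hχ hδ₀ hχ1 hχ0 T
  refine ⟨B, hB0, fun μ hμ1 hμ4 => ?_⟩
  have hμ0 : 0 < μ := by linarith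
  refine ⟨fun t x => f (x - X t) * (a t * cexp (I * μ * ((θ t : ℂ) + (ξ t : ℂ) * ((x : ℂ) - X t)
    + Γ t / 2 * ((x : ℂ) - X t) ^ 2))).re, ?_, ?_, ?_, ?_, ?_⟩
  · -- jointly `C²`
    have h1 : ContDiff ℝ 2 fun p : ℝ × ℝ => f (p.2 - X p.1) :=
      hχ.comp (contDiff_snd.sub (hX2.comp contDiff_fst))
    have h2 := Complex.reCLM.contDiff.comp (contDiff_beam (μ := μ) hX2 hξ2 hθ2 hΓ2 ha2)
    exact h1.mul h2
  · -- support in the slab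
    intro t x hx
    exact cutBeam_eq_zero_of_le hχ0 hx
  · -- rest datum: `∂_t G(0, ·) = 0`
    intro x
    have ha0im : (a 0).im = 0 := by rw [ha0]; simp
    have hda0re : (deriv a 0).re = 0 := by
      have h : deriv a 0 = ((-(1 / (2 * Real.sqrt (q X₀))) : ℝ) : ℂ) * I := by
        rw [hda0]; push_cast; ring
      rw [h, Complex.re_ofReal_mul, Complex.I_re, mul_zero]
    exact cutBeam_initial_deriv hχ hX2 hξ2 hθ2 hΓ2 ha2 hξ0 hθ0 hΓ0 ha0im hdX0 hda0re hdΓ0 x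
  · -- residual bound on `[0, T]`
    intro t ht
    refine integral_sq_le_of_bound (c := X t) hμ0.le hδ₀.le (fun x => ?_) (fun x hx => ?_)
    · have h := hB μ hμ1 t ht x
      exact h
    · -- off the slab the cut beam vanishes near `(t, x)`, so its residual vanishes
      have hopen : IsOpen {p : ℝ × ℝ | δ₀ < |p.2 - X p.1|} :=
        isOpen_lt continuous_const ((continuous_snd.sub (hX2.continuous.comp continuous_fst)).abs)
      have hG0 : ∀ p : ℝ × ℝ, δ₀ < |p.2 - X p.1| →
          f (p.2 - X p.1) * (a p.1 * cexp (I * μ * ((θ p.1 : ℂ) + (ξ p.1 : ℂ) * ((p.2 : ℂ) - X p.1)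
            + Γ p.1 / 2 * ((p.2 : ℂ) - X p.1) ^ 2))).re = 0 := fun p hp =>
        cutBeam_eq_zero_of_le hχ0 hp.le
      have ht' : (fun τ => f (x - X τ) * (a τ * cexp (I * μ * ((θ τ : ℂ) + (ξ τ : ℂ) * ((x : ℂ) - X τ)
          + Γ τ / 2 * ((x : ℂ) - X τ) ^ 2))).re) =ᶠ[𝓝 t] fun _ => 0 := by
        have hc : Continuous fun τ : ℝ => (τ, x) := Continuous.prodMk_left x
        have hmem : {p : ℝ × ℝ | δ₀ < |p.2 - X p.1|} ∈ 𝓝 (t, x) := hopen.mem_nhds hx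
        filter_upwards [hc.continuousAt.preimage_mem_nhds hmem] with τ hτ
        exact hG0 (τ, x) hτ
      have hx' : (fun y => f (y - X t) * (a t * cexp (I * μ * ((θ t : ℂ) + (ξ t : ℂ) * ((y : ℂ) - X t)
          + Γ t / 2 * ((y : ℂ) - X t) ^ 2))).re) =ᶠ[𝓝 x] fun _ => 0 := by
        have hc : Continuous fun y : ℝ => (t, y) := Continuous.prodMk_right t
        have hmem : {p : ℝ × ℝ | δ₀ < |p.2 - X p.1|} ∈ 𝓝 (t, x) := hopen.mem_nhds hx
        filter_upwards [hc.continuousAt.preimage_mem_nhds hmem] with y hy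
        exact hG0 (t, y) hy
      obtain ⟨h0, -, h2t⟩ := derivs_eq_zero_of_eventuallyEq_zero ht'
      obtain ⟨-, -, h2x⟩ := derivs_eq_zero_of_eventuallyEq_zero hx'
      simp only
      rw [h2t, h2x, h0, mul_zero, sub_zero, add_zero]
  · -- potential energy of the Gaussian datum
    intro q₀ hq₀ hqI
    have hinit : ∀ x, f (x - X 0) * (a 0 * cexp (I * μ * ((θ 0 : ℂ) + (ξ 0 : ℂ) * ((x : ℂ) - X 0)
        + Γ 0 / 2 * ((x : ℂ) - X 0) ^ 2))).re
        = f (x - X₀) * 1 * Real.exp (-(μ * 1 * (x - X₀) ^ 2 / 2)) := by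
      intro x
      rw [cutBeam_initial (μ := μ) (β₀ := 1) hX0 hξ0 hθ0 hΓ0 x, ha0, Complex.one_re]
    have hμ4' : 4 / (1 * δ₀ ^ 2) ≤ μ := by rwa [one_mul]
    have hS : ∀ x ∈ Icc (X₀ - 1 / Real.sqrt (μ * 1)) (X₀ + 1 / Real.sqrt (μ * 1)),
        μ ^ 2 * q₀ * Real.exp (-1) ≤ μ ^ 2 * q x
          * (f (x - X 0) * (a 0 * cexp (I * μ * ((θ 0 : ℂ) + (ξ 0 : ℂ) * ((x : ℂ) - X 0)
            + Γ 0 / 2 * ((x : ℂ) - X 0) ^ 2))).re) ^ 2 := by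
      intro x hx
      rw [hinit x]
      have h := cutBeam_initial_potential_ge (χ := f) (q := q) (X₀ := X₀) (a₀ := 1) one_pos hδ₀
        hμ4' hq₀ hχ1 hqI hx
      simpa only [one_pow, mul_one] using h
    have hlow := lintegral_ofReal_ge_of_le_on_Icc (by positivity) hS
    have hwidth : X₀ + 1 / Real.sqrt (μ * 1) - (X₀ - 1 / Real.sqrt (μ * 1)) = 2 / Real.sqrt μ := by
      rw [mul_one]; ring
    rw [hwidth] at hlow
    exact hlow

/-! ### The constants of the lag law (saddle-point rate and continuity radius) -/

/-- **The constants of the lag law.** For `0 < θ < 3√3` put `θ′ = (θ + 3√3)/2`, `λ′ = 1/(θ′M)`;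
since `λ′² > 1/(27M²) = κ/(2q(0))` (`κ = −q″(0) = 2/(729M⁴)`), continuity of `q` and `q″` at `0`
gives `D > 0` with `−q′(x) ≤ 2 q(X₀) λ′² x` for all `x, X₀ ∈ [0, D]`; and for `ρ < ρ₁ ≤ D/3` the
horizon `T = log(D/(3ρ))/λ′ = θ′M log(D/(3ρ))` satisfies `θ M log(M/ρ) ≤ T − D`. -/
theorem lagLaw_constants {q : ℝ → ℝ} {M θ : ℝ} (hM : 0 < M) (hθ0 : 0 < θ)
    (hθ : θ < 3 * Real.sqrt 3) (hq2 : ContDiff ℝ 2 q) (hq'0 : deriv q 0 = 0)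
    (hq0 : q 0 = 1 / (27 * M ^ 2)) (hq''0 : iteratedDeriv 2 q 0 = -2 / (729 * M ^ 4)) :
    ∃ lam D ρ₁ : ℝ, 0 < lam ∧ 0 < D ∧ 0 < ρ₁ ∧ ρ₁ ≤ D / 3 ∧
      (∀ X₀ ∈ Icc 0 D, ∀ x ∈ Icc 0 D, -(deriv q x) ≤ 2 * q X₀ * lam ^ 2 * x) ∧
      ∀ ρ : ℝ, 0 < ρ → ρ < ρ₁ → θ * M * Real.log (M / ρ) ≤ Real.log (D / 3 / ρ) / lam - D := by
  /- the rate `λ′` and the gap `g = 2q(0)λ′² − κ > 0` -/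
  have h3 : Real.sqrt 3 ^ 2 = 3 := Real.sq_sqrt (by norm_num)
  have hs3 : 0 < Real.sqrt 3 := Real.sqrt_pos.2 (by norm_num)
  obtain ⟨θ', hθ'0, hθθ', hθ'3⟩ : ∃ θ' : ℝ, 0 < θ' ∧ θ < θ' ∧ θ' < 3 * Real.sqrt 3 :=
    ⟨(θ + 3 * Real.sqrt 3) / 2, by positivity, by linarith, by linarith⟩
  obtain ⟨lam, hlam⟩ : ∃ lam : ℝ, lam = 1 / (θ' * M) := ⟨_, rfl⟩
  have hlam0 : 0 < lam := by rw [hlam]; positivity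
  obtain ⟨κ, hκ⟩ : ∃ κ : ℝ, κ = 2 / (729 * M ^ 4) := ⟨_, rfl⟩
  have hκ0 : 0 < κ := by rw [hκ]; positivity
  obtain ⟨g, hg⟩ : ∃ g : ℝ, g = 2 * q 0 * lam ^ 2 - κ := ⟨_, rfl⟩
  have hg0 : 0 < g := by
    have hθ'sq : θ' ^ 2 < 27 := by nlinarith
    have hM2 : 0 < M ^ 2 := pow_pos hM 2
    have h1 : 1 / (27 * M ^ 2) < lam ^ 2 := by
      rw [hlam, div_pow, one_pow, mul_pow, div_lt_div_iff₀ (by positivity) (by positivity),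
        one_mul, one_mul]
      exact mul_lt_mul_of_pos_right hθ'sq hM2
    have e : g = 2 / (27 * M ^ 2) * (lam ^ 2 - 1 / (27 * M ^ 2)) := by
      rw [hg, hq0, hκ]; field_simp; ring
    rw [e]
    exact mul_pos (by positivity) (by linarith)
  /- `D`: continuity of `q″` and `q` at `0` -/
  have hcq'' : Continuous (deriv (deriv q)) := (hq2.deriv').continuous_deriv le_rfl
  have hcq : Continuous q := hq2.continuous
  have hdq : Differentiable ℝ (deriv q) := (hq2.deriv').differentiable one_ne_zero
  have hq''0' : deriv (deriv q) 0 = -κ := by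
    have h := hq''0
    rw [iteratedDeriv_succ, iteratedDeriv_one] at h
    rw [h, hκ, neg_div]
  obtain ⟨δ₁, hδ₁, hδ₁'⟩ := Metric.continuousAt_iff.1 hcq''.continuousAt (g / 4) (by positivity)
  obtain ⟨δ₂, hδ₂, hδ₂'⟩ := Metric.continuousAt_iff.1 hcq.continuousAt (g / (8 * lam ^ 2))
    (by positivity)
  obtain ⟨D, hD⟩ : ∃ D : ℝ, D = min δ₁ δ₂ / 2 := ⟨_, rfl⟩
  have hD0 : 0 < D := by rw [hD]; positivity
  have hDδ₁ : D < δ₁ := by rw [hD]; linarith [min_le_left δ₁ δ₂, lt_min hδ₁ hδ₂]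
  have hDδ₂ : D < δ₂ := by rw [hD]; linarith [min_le_right δ₁ δ₂, lt_min hδ₁ hδ₂]
  have hq''D : ∀ s ∈ Icc 0 D, -κ - g / 4 ≤ deriv (deriv q) s := by
    intro s hs
    have h := hδ₁' (x := s)
      (by rw [dist_zero_right, Real.norm_eq_abs, abs_of_nonneg hs.1]; linarith [hs.2])
    rw [hq''0', Real.dist_eq, abs_lt] at h
    linarith [h.1]
  have hqD : ∀ s ∈ Icc 0 D, q 0 - g / (8 * lam ^ 2) ≤ q s := by
    intro s hs
    have h := hδ₂' (x := s)
      (by rw [dist_zero_right, Real.norm_eq_abs, abs_of_nonneg hs.1]; linarith [hs.2])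
    rw [Real.dist_eq, abs_lt] at h
    linarith [h.1]
  /- `−q′(x) ≤ (κ + g/4)·x ≤ 2 q(X₀) λ′² x` on `[0, D]` -/
  have hq'D : ∀ x ∈ Icc 0 D, -(deriv q x) ≤ (κ + g / 4) * x := by
    intro x hx
    have h := Convex.mul_sub_le_image_sub_of_le_deriv (convex_Icc 0 D) (f := deriv q)
      hdq.continuous.continuousOn (hdq.differentiableOn.mono interior_subset) (C := -κ - g / 4)
      (fun s hs => hq''D s (interior_subset hs)) 0 (left_mem_Icc.2 hD0.le) x hx hx.1
    rw [hq'0, sub_zero, sub_zero] at h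
    linarith
  have hKD : ∀ X₀ ∈ Icc 0 D, ∀ x ∈ Icc 0 D, -(deriv q x) ≤ 2 * q X₀ * lam ^ 2 * x := by
    intro X₀ hX₀ x hx
    have h2 := hqD X₀ hX₀
    have e : 2 * lam ^ 2 * (q 0 - g / (8 * lam ^ 2)) = κ + 3 * (g / 4) := by
      rw [hg]; field_simp; ring
    have i := mul_le_mul_of_nonneg_left h2 (by positivity : (0 : ℝ) ≤ 2 * lam ^ 2)
    rw [e] at i
    have j : (κ + g / 4) * x ≤ 2 * q X₀ * lam ^ 2 * x := by
      refine mul_le_mul_of_nonneg_right ?_ hx.1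
      linarith
    linarith [hq'D x hx]
  /- `ρ₁` and the horizon inequality -/
  obtain ⟨L₀, hL₀⟩ : ∃ L₀ : ℝ,
      L₀ = (D + θ * M * Real.log M - θ' * M * Real.log (D / 3)) / ((θ' - θ) * M) := ⟨_, rfl⟩
  refine ⟨lam, D, min (D / 3) (Real.exp (-L₀)), hlam0, hD0, lt_min (by positivity) (Real.exp_pos _),
    min_le_left _ _, hKD, ?_⟩
  intro ρ hρ hρ₁
  have hρL : ρ < Real.exp (-L₀) := lt_of_lt_of_le hρ₁ (min_le_right _ _)
  have hlogρ : Real.log ρ ≤ -L₀ := by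
    have := Real.log_le_log hρ hρL.le
    rwa [Real.log_exp] at this
  have e1 : Real.log (M / ρ) = Real.log M - Real.log ρ := Real.log_div hM.ne' hρ.ne'
  have e2 : Real.log (D / 3 / ρ) = Real.log (D / 3) - Real.log ρ :=
    Real.log_div (by positivity) hρ.ne'
  have e3 : Real.log (D / 3 / ρ) / lam = θ' * M * (Real.log (D / 3) - Real.log ρ) := by
    rw [e2, hlam]; field_simp
  rw [e1, e3]
  have hpos : 0 < (θ' - θ) * M := mul_pos (by linarith) hM
  have hL : L₀ * ((θ' - θ) * M) = D + θ * M * Real.log M - θ' * M * Real.log (D / 3) := by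
    rw [hL₀, div_mul_cancel₀ _ hpos.ne']
  nlinarith [mul_le_mul_of_nonneg_right hlogρ hpos.le]

/-- **Registered sub-goal `stub_lagLawBeam` of stmt-FinalStateConjecture-14085** (seat 1, the
logarithmic lag law): the cut rest-beam package with explicit binders. -/
theorem stub_lagLawBeam : ∀ (q : ℝ → ℝ) (K : NNReal) (X₀ δ₀ T : ℝ), ContDiff ℝ 3 q → LipschitzWith K (deriv q) → (∀ x, 0 < q x) → 0 < δ₀ → ∃ (X ξ : ℝ → ℝ), X 0 = X₀ ∧ ξ 0 = 0 ∧ ContDiff ℝ 2 X ∧ (∀ t, HasDerivAt X (ξ t / Real.sqrt (q X₀)) t) ∧ (∀ t, HasDerivAt ξ (-(deriv q (X t)) / (2 * Real.sqrt (q X₀))) t) ∧ (∀ t, |X t - X 0| ≤ |t|) ∧ ∃ B : ℝ, 0 ≤ B ∧ ∀ μ : ℝ, 1 ≤ μ → 4 / δ₀ ^ 2 ≤ μ → ∃ G : ℝ → ℝ → ℝ, ContDiff ℝ 2 (Function.uncurry G) ∧ (∀ t x, δ₀ ≤ |x - X t| → G t x = 0) ∧ (∀ x, deriv (fun τ =>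 G τ x) 0 = 0) ∧ (∀ t ∈ Set.Icc 0 T, ∫ x, (iteratedDeriv 2 (fun τ => G τ x) t - iteratedDeriv 2 (G t) x + μ ^ 2 * q x * G t x) ^ 2 ≤ 2 * δ₀ * (B ^ 2 * μ)) ∧ ∀ q₀ : ℝ, 0 ≤ q₀ → (∀ x ∈ Set.Icc (X₀ - δ₀) (X₀ + δ₀), q₀ ≤ q x) → ENNReal.ofReal (μ ^ 2 * q₀ * Real.exp (-1) * (2 / Real.sqrt μ)) ≤ ∫⁻ x, ENNReal.ofReal (μ ^ 2 * q x * G 0 x ^ 2) := by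
  intro q K X₀ δ₀ T hq hK hqpos hδ₀
  exact beam_package hq hK hqpos X₀ hδ₀ T

end Summit.FinalStateConjecture.FinalStateConjecture.Theorems.LagLaw
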